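import Mathlib
import HarnessLib
import Summits.HubbardSuperconductivity.HubbardSuperconductivity.Theses.SeamInduction

/-!
# Crux `SeamGluingLocality` (item `stmt-HubbardSuperconductivity-18509`): hidden universal claims

Negative-side support (standing disprover, cycle 1). `seamGluingLocality_hidden`: the crux
`Theses.SeamInduction.SeamGluingLocality` (one-seam locality, multiplicative factor `1 ∓ M₂/M`,
stated for EVERY `U > 0`, `δ ∈ (0,3/10)`) implies, at every point of the window and eventually in
the sizes, on ALL admissible glued even tubes: the UNCONDITIONAL sign claims `0 ≤ stiff_M`
(`E(π/3) ≥ E(0)`) and `0 ≤ icomp_M` (`Δ²_N E ≥ 0`), the EXACT DEGENERACY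
`icomp′ ≤ 0 → icomp″ ≤ 0 → icomp_M = 0`, heredity of positive minima with the absolute factor
`1/2`, and the doubling ceiling with factor `2` — none of which the route's `closes` uses (it
consumes the crux only at the witness point of `PerWidthThermodynamics`, above a floor). These are
the handles of the kill lemmas in `KillMenu.lean`. First observed in the refuters' evidence files
`SeamNonneg.lean` / `SeamHiddenClaims.lean` on the item; typed here over the crux's verbatim
let-prefix. Folklore; no definitions; nothing asserts a Theses declaration.
-/

namespace Summit.HubbardSuperconductivity.SeamGluingLocality.Negative

open scoped BigOperators Topology Manifold Classical MeasureTheory ProbabilityTheory Matrix InnerProductSpace ComplexConjugate ContinuousMap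
open Filter Set Function TopologicalSpace MeasureTheory
open Literature.Hubbard
open Summit.HubbardSuperconductivity.HubbardSuperconductivity.Theses.SeamInduction

/-- The three crux inequalities at one gluing, with boundary parameter `a = M₂/M ∈ [0, 1/2]`
(`M₂ ≤ M′, M″` forces `2M₂ ≤ M`), already imply: signs of the glued responses, exact degeneracy
when both parts are unstable, heredity of positive minima with factor `1/2`, and the doubling
ceiling with factor `2`. [folklore] -/
theorem locality_arith {a s s' s'' c c' c'' : ℝ} (ha0 : 0 ≤ a) (ha : a ≤ 1 / 2)
    (h1 : (1 - a) * max (min s' s'') 0 ≤ s) (h2 : (1 - a) * max (min c' c'') 0 ≤ c)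
    (h3 : c ≤ (1 + a) * max (max c' c'') 0) :
    0 ≤ s ∧ 0 ≤ c ∧ (c' ≤ 0 → c'' ≤ 0 → c = 0) ∧
      (0 < min s' s'' → min s' s'' / 2 ≤ s) ∧ (0 < min c' c'' → min c' c'' / 2 ≤ c) ∧
      c ≤ 2 * max (max c' c'') 0 := by
  have hf0 : (0 : ℝ) ≤ 1 - a := by linarith
  have hs : 0 ≤ s := le_trans (mul_nonneg hf0 (le_max_right _ _)) h1
  have hc : 0 ≤ c := le_trans (mul_nonneg hf0 (le_max_right _ _)) h2
  refine ⟨hs, hc, ?_, ?_, ?_, ?_⟩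
  · intro h' h''
    have hz : max (max c' c'') 0 = 0 := max_eq_right (max_le h' h'')
    rw [hz, mul_zero] at h3
    exact le_antisymm h3 hc
  · intro hpos
    rw [max_eq_left hpos.le] at h1
    nlinarith
  · intro hpos
    rw [max_eq_left hpos.le] at h2
    nlinarith
  · have hm : 0 ≤ max (max c' c'') 0 := le_max_right _ _
    nlinarith

/-- Arithmetic of Kill 5: with `a ≤ 1/2`, a positive part value `x` and the glued value `c`
squeezed by (2)–(3), `c` lies in `[x/2, 3x/2]`. [folklore] -/
theorem jump_arith {a c x : ℝ} (ha : a ≤ 1 / 2) (hpos : 0 < x)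
    (h2 : (1 - a) * max x 0 ≤ c) (h3 : c ≤ (1 + a) * max x 0) :
    ¬ (c < x / 2 ∨ 3 / 2 * x < c) := by
  rw [max_eq_left hpos.le] at h2 h3
  rintro (h | h) <;> nlinarith

/-- **Hidden universal claims of `SeamGluingLocality`.** For EVERY `U > 0` and `δ ∈ (0,3/10)`
(not only at the witness point where `closes` consumes the crux) there are `M₂, L₂` such that for
all admissible gluings: (i) `0 ≤ stiff_M` and (ii) `0 ≤ icomp_M` — UNCONDITIONAL sign claims on
every wide glued even tube (`E(π/3) ≥ E(0)`: no paramagnetic tube; `Δ²_N E ≥ 0`: no concave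
even-`N` staircase), although the informal text says "nothing is claimed from paramagnetic or
unstable parts"; (iii) EXACT DEGENERACY `icomp′ ≤ 0 → icomp″ ≤ 0 → icomp_M = 0`; (iv), (v)
heredity of positive minima with the absolute factor `1/2`; (vi) doubling ceiling with factor `2`.
(i)–(ii) re-derive the refuters' `SeamNonneg.lean`, (iii) the prover's `SeamHiddenClaims.lean`
(evidence files on the item); typed here over the verbatim let-prefix so that the `false_of`
lemmas of `KillMenu.lean` are one-liners. [folklore] -/
theorem seamGluingLocality_hidden (h : SeamGluingLocality) :
    open Matrix Literature.MathematicalPhysics.QuantumLattice in let H0 : ∀ (L M : ℕ) (Λ : Type) [LinearOrder Λ] [Fintype Λ], (Λ ≃ ZMod L × ZMod M) → ℝ → Matrix (Finset (Orb Λ)) (Finset (Orb Λ)) ℂ := fun _ _ Λ _ _ e U => hamiltonian (SimpleGraph.fromRel fun x y : Λ => y = e.symm ((e x).1 + 1, (e x).2) ∨ y = e.symm ((e x).1, (e x).2 + 1)) 1 U; let Tw : ∀ (L M : ℕ) [NeZero L] [NeZero M] (Λ : Type) [LinearOrder Λ] [Fintype Λ], (Λ ≃ ZMod L × ZMod M)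 → ℝ → Matrix (Finset (Orb Λ)) (Finset (Orb Λ)) ℂ := fun _ M _ _ _ _ _ e θ => ∑ b : ZMod M, ∑ σ : Fin 2, ((1 - Complex.exp (Complex.I * θ)) • (creation (orb (e.symm (0, b)) σ) * annihilation (orb (e.symm (-1, b)) σ)) + (1 - Complex.exp (-(Complex.I * θ))) • (creation (orb (e.symm (-1, b)) σ) * annihilation (orb (e.symm (0, b)) σ))); let E : ∀ (L M : ℕ) [NeZero L] [NeZero M] (Λ : Type) [LinearOrder Λ] [Fintype Λ], (Λ ≃ ZMod L × ZMod M) → ℝ → ℝ → ℕ → ℝ := fun L M _ _ Λ _ _ e U θ N => (H0 L M Λ e U + Tw L M Λ e θ).minEnergyOn (szSector N 0); let Np : ℕ → ℕ → ℝ → ℕ := fun L M δ => 2 * ⌊(1 - δ) * ((L : ℝ) * (M : ℝ)) / 2⌋₊; let stiff : ∀ (L M : ℕ) [NeZero L] [NeZero M] (Λ : Type) [LinearOrder Λ] [Fintype Λ], (Λ ≃ ZMod L × ZMod M) → ℝ → ℝ → ℝ := fun L M _ _ Λ _ _ e U δ => 2 * (L : ℝ) * (E L M Λ e U (Real.pi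 / 3) (Np L M δ) - E L M Λ e U 0 (Np L M δ)) / ((Real.pi / 3) ^ 2 * (M : ℝ)); let icomp : ∀ (L M : ℕ) [NeZero L] [NeZero M] (Λ : Type) [LinearOrder Λ] [Fintype Λ], (Λ ≃ ZMod L × ZMod M) → ℝ → ℝ → ℝ := fun L M _ _ Λ _ _ e U δ => (L : ℝ) * (M : ℝ) * (E L M Λ e U 0 (Np L M δ + 2) + E L M Λ e U 0 (Np L M δ - 2) - 2 * E L M Λ e U 0 (Np L M δ)) / 4; ∀ U : ℝ, 0 < U → ∀ δ ∈ Set.Ioo (0 : ℝ) (3 / 10), ∃ M₂ L₂ : ℕ, ∀ (L M' M'' M : ℕ) [NeZero L] [NeZero M'] [NeZero M''] [NeZero M], Even L → Even M' → Even M'' → M₂ ≤ M' → M₂ ≤ M'' → M' + M'' = M → M ≤ L → L₂ ≤ L → ∀ (Λ' : Type) [LinearOrder Λ'] [Fintype Λ'] (e' : Λ' ≃ ZMod L × ZMod M') (Λ'' : Type) [LinearOrder Λ''] [Fintype Λ''] (e'' : Λ'' ≃ ZMod L × ZMod M'') (Λ : Type) [LinearOrder Λ] [Fintype Λ] (e :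 Λ ≃ ZMod L × ZMod M), 0 ≤ stiff L M Λ e U δ ∧ 0 ≤ icomp L M Λ e U δ ∧ (icomp L M' Λ' e' U δ ≤ 0 → icomp L M'' Λ'' e'' U δ ≤ 0 → icomp L M Λ e U δ = 0) ∧ (0 < min (stiff L M' Λ' e' U δ) (stiff L M'' Λ'' e'' U δ) → min (stiff L M' Λ' e' U δ) (stiff L M'' Λ'' e'' U δ) / 2 ≤ stiff L M Λ e U δ) ∧ (0 < min (icomp L M' Λ' e' U δ) (icomp L M'' Λ'' e'' U δ) → min (icomp L M' Λ' e' U δ) (icomp L M'' Λ'' e'' U δ) / 2 ≤ icomp L M Λ e U δ) ∧ icomp L M Λ e U δ ≤ 2 * max (max (icomp L M' Λ' e' U δ) (icomp L M'' Λ'' e'' U δ)) 0 := by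
  dsimp only
  intro U hU δ hδ
  obtain ⟨M₂, L₂, hC⟩ := h U hU δ hδ
  refine ⟨M₂, L₂, ?_⟩
  intro L M' M'' M _ _ _ _ hL hM' hM'' h2' h2'' hsum hML hL₂ Λ' _ _ e' Λ'' _ _ e'' Λ _ _ e
  obtain ⟨h1, h2, h3⟩ := hC L M' M'' M hL hM' hM'' h2' h2'' hsum hML hL₂ Λ' e' Λ'' e'' Λ e
  have hM0 : (0 : ℝ) < M := by exact_mod_cast Nat.pos_of_ne_zero (NeZero.ne M)
  have h2M : (2 : ℝ) * M₂ ≤ M := by exact_mod_cast (show 2 * M₂ ≤ M by omega)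
  have ha : (M₂ : ℝ) / M ≤ 1 / 2 := by
    rw [div_le_iff₀ hM0]; linarith
  exact locality_arith (by positivity) ha h1 h2 h3

end Summit.HubbardSuperconductivity.SeamGluingLocality.Negative
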